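import Mathlib.Algebra.MvPolynomial.Monad
import Literature.Computability.MetaComplexity.PolynomialCalculusMultilinear
import HarnessLib

/-!
# `0/1` restrictions of one variable, and their interaction with multilinearisation

Second toolkit file for the polynomial calculus in multilinear representation and the
size–degree trade-off of Impagliazzo–Pudlák–Sgall (continuing
`PolynomialCalculusMultilinear.lean`):

* `MLPC.restrictVar K j b` (`b : Bool`) — the substitution `x_j := b` (`0` or `1`) as a
  `K`-algebra endomorphism of `K[x̄]` (`MvPolynomial.bind₁`);
* its action on monomials, coefficients and supports for `b = 0` (the monomials avoiding `x_j`
  survive unchanged, the others die) and `b = 1` (`x^s ↦ x^{s ∖ j}`; for multilinear `p` a monomial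
  `t` of `p|_{x_j:=1}` comes from `t` or from `t·x_j`) — the two counting facts of the
  Clegg–Edmonds–Impagliazzo restriction argument;
* `ml ∘ restrictVar = restrictVar ∘ ml`, restriction preserves multilinearity, does not raise the
  degree, keeps the variables, and fixes polynomials not mentioning `x_j`;
* `MLPC.bigMons D g` — the FAT monomials of a line (those with `≥ D` variables), the size currency
  of the Impagliazzo–Pudlák–Sgall argument; under `x_j := 0` they shrink to the members avoiding
  `x_j`, under `x_j := 1` they move into `MLPC.descend j D M` (no larger than `M`, one variable
  fewer); `MLPC.exists_var_many` — double counting: some variable lies in a `D/n` fraction of a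
  family of fat monomials.

References: M. Clegg, J. Edmonds, R. Impagliazzo, Proc. 28th STOC (1996) (the restriction
argument); R. Impagliazzo, P. Pudlák, J. Sgall, Comput. Complexity 8 (1999)
[ImpagliazzoPudlakSgall1999]; J. Krajíček, *Proof Complexity* (2019), Thm. 16.2.4
[KrajicekProofComplexity2019].

Design note: `Literature/Computability/QuantumComplexity/AaronsonAmbainisProofs.lean` has the
special case `restrictPoly` (`σ = Fin N`, `K = ℝ`, via `aeval`); a librarian may merge the two.
-/

noncomputable section

namespace Literature.Computability.MetaComplexity.MLPC

open Finset MvPolynomial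

variable {σ : Type*} {K : Type*} [Field K]

/-! ### Restricting one variable to `0` or `1` -/

variable [DecidableEq σ]

variable (K) in
/-- The RESTRICTION `x_j := b` (`b ∈ {0, 1}`, as a Boolean) as a `K`-algebra endomorphism of
`K[x̄]`: `x_j ↦ b`, `x_i ↦ x_i` for `i ≠ j`. [Impagliazzo–Pudlák–Sgall 1999;
Clegg–Edmonds–Impagliazzo 1996] [folklore] -/
def restrictVar (j : σ) (b : Bool) : MvPolynomial σ K →ₐ[K] MvPolynomial σ K :=
  bind₁ fun i => if i = j then (if b then 1 else 0) else X i

/-- The restricted variable becomes the constant. [folklore] -/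
@[simp] theorem restrictVar_X_self (j : σ) (b : Bool) :
    restrictVar K j b (X j) = if b then 1 else 0 := by
  rw [restrictVar, bind₁_X_right, if_pos rfl]

/-- Other variables are untouched. [folklore] -/
@[simp] theorem restrictVar_X_ne {i j : σ} (h : i ≠ j) (b : Bool) :
    restrictVar K j b (X i) = X i := by
  rw [restrictVar, bind₁_X_right, if_neg h]

/-- Restriction by `x_j := 1` on a monomial: `x^s ↦ x^{s ∖ j}`. [folklore] -/
theorem restrictVar_true_monomial (j : σ) (s : σ →₀ ℕ) (a : K) :
    restrictVar K j true (monomial s a) = monomial (s.erase j) a := by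
  rw [restrictVar, bind₁_monomial, monomial_eq, Finsupp.prod, Finsupp.support_erase]
  congr 1
  by_cases hj : j ∈ s.support
  · rw [← Finset.prod_erase_mul _ _ hj, if_pos rfl, if_pos rfl, one_pow, mul_one]
    refine Finset.prod_congr rfl fun i hi => ?_
    rw [Finset.mem_erase] at hi
    rw [if_neg hi.1, Finsupp.erase_ne hi.1]
  · rw [Finset.erase_eq_of_notMem hj]
    refine Finset.prod_congr rfl fun i hi => ?_
    have hij : i ≠ j := fun h => hj (h ▸ hi)
    rw [if_neg hij, Finsupp.erase_ne hij]

/-- Restriction by `x_j := 0` on a monomial: kept if `x_j` does not occur, killed otherwise.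
[folklore] -/
theorem restrictVar_false_monomial (j : σ) (s : σ →₀ ℕ) (a : K) :
    restrictVar K j false (monomial s a) = if s j = 0 then monomial s a else 0 := by
  rw [restrictVar, bind₁_monomial]
  by_cases hj : s j = 0
  · rw [if_pos hj, monomial_eq, Finsupp.prod]
    congr 1
    refine Finset.prod_congr rfl fun i hi => ?_
    have hij : i ≠ j := fun h => (Finsupp.mem_support_iff.1 hi) (h ▸ hj)
    rw [if_neg hij]
  · rw [if_neg hj]
    have hjs : j ∈ s.support := Finsupp.mem_support_iff.2 hj
    rw [← Finset.prod_erase_mul _ _ hjs, if_pos rfl]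
    simp [hj]

/-- Coefficients after `x_j := 0`. [folklore] -/
theorem coeff_restrictVar_false (j : σ) (p : MvPolynomial σ K) (t : σ →₀ ℕ) :
    coeff t (restrictVar K j false p) = if t j = 0 then coeff t p else 0 := by
  conv_lhs => rw [p.as_sum, map_sum, coeff_sum]
  simp only [restrictVar_false_monomial]
  split_ifs with ht
  · conv_rhs => rw [p.as_sum, coeff_sum]
    refine Finset.sum_congr rfl fun s _ => ?_
    split_ifs with hs
    · rfl
    · rw [coeff_zero, coeff_monomial, if_neg]
      rintro rfl; exact hs ht
  · refine Finset.sum_eq_zero fun s _ => ?_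
    split_ifs with hs
    · rw [coeff_monomial, if_neg]
      rintro rfl; exact ht hs
    · rfl

/-- Support after `x_j := 0`: the monomials of `p` avoiding `x_j`. [folklore] -/
theorem support_restrictVar_false (j : σ) (p : MvPolynomial σ K) :
    (restrictVar K j false p).support = p.support.filter fun s => s j = 0 := by
  ext t
  rw [mem_support_iff, coeff_restrictVar_false, Finset.mem_filter, mem_support_iff]
  split_ifs with h <;> simp [h]

/-- `x_j := 1` as a sum over the monomials. [folklore] -/
theorem restrictVar_true_eq_sum (j : σ) (p : MvPolynomial σ K) :
    restrictVar K j true p = ∑ s ∈ p.support, monomial (s.erase j) (coeff s p) := by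
  conv_lhs => rw [p.as_sum, map_sum]
  exact Finset.sum_congr rfl fun s _ => restrictVar_true_monomial j s _

/-- Coefficients after `x_j := 1`. [folklore] -/
theorem coeff_restrictVar_true (j : σ) (p : MvPolynomial σ K) (t : σ →₀ ℕ) :
    coeff t (restrictVar K j true p) = ∑ s ∈ p.support with s.erase j = t, coeff s p := by
  rw [restrictVar_true_eq_sum, coeff_sum, Finset.sum_filter]
  exact Finset.sum_congr rfl fun s _ => by rw [coeff_monomial]

/-- Support after `x_j := 1`: erasures of monomials of `p`. [folklore] -/
theorem support_restrictVar_true_subset (j : σ) (p : MvPolynomial σ K) :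
    (restrictVar K j true p).support ⊆ p.support.image fun s => s.erase j := by
  intro t ht
  rw [mem_support_iff, coeff_restrictVar_true] at ht
  obtain ⟨s, hs, _⟩ := Finset.exists_ne_zero_of_sum_ne_zero ht
  rw [Finset.mem_filter] at hs
  exact Finset.mem_image.2 ⟨s, hs.1, hs.2⟩

/-- For a MULTILINEAR `p`, a monomial `t` of `p|_{x_j := 1}` avoids `x_j` and comes from the
monomial `t` or the monomial `t · x_j` of `p`. [Impagliazzo–Pudlák–Sgall 1999] [folklore] -/
theorem mem_support_restrictVar_true_of_ml_eq_self {p : MvPolynomial σ K} (hp : ml K p = p)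
    {j : σ} {t : σ →₀ ℕ} (ht : t ∈ (restrictVar K j true p).support) :
    t j = 0 ∧ (t ∈ p.support ∨ t + Finsupp.single j 1 ∈ p.support) := by
  obtain ⟨s, hs, rfl⟩ := Finset.mem_image.1 (support_restrictVar_true_subset j p ht)
  refine ⟨Finsupp.erase_same, ?_⟩
  have h1 : s j ≤ 1 := (mlMon_eq_self_iff s).1 (mlMon_eq_of_ml_eq_self hp hs) j
  rcases Nat.le_one_iff_eq_zero_or_eq_one.1 h1 with h0 | h1
  · left
    rwa [show s.erase j = s from by
      ext i; by_cases hij : i = j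
      · rw [hij, Finsupp.erase_same, h0]
      · rw [Finsupp.erase_ne hij]]
  · right
    rwa [← h1, Finsupp.erase_add_single]

/-- **`ml` commutes with `0/1` restrictions.** [folklore] -/
theorem ml_restrictVar (j : σ) (b : Bool) (p : MvPolynomial σ K) :
    ml K (restrictVar K j b p) = restrictVar K j b (ml K p) := by
  induction p using MvPolynomial.induction_on' with
  | monomial s a =>
    cases b
    · rw [restrictVar_false_monomial, ml_monomial, restrictVar_false_monomial, mlMon_apply]
      by_cases h : s j = 0
      · rw [if_pos h, if_pos (by rw [h]; rfl), ml_monomial]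
      · rw [if_neg h, if_neg (by omega), map_zero]
    · rw [restrictVar_true_monomial, ml_monomial, ml_monomial, restrictVar_true_monomial,
        mlMon_erase]
  | add p q ihp ihq => simp only [map_add, ihp, ihq]

/-- Hence `0/1` restrictions preserve multilinearity. [folklore] -/
theorem ml_restrictVar_of_ml_eq_self {p : MvPolynomial σ K} (hp : ml K p = p) (j : σ) (b : Bool) :
    ml K (restrictVar K j b p) = restrictVar K j b p := by
  rw [ml_restrictVar, hp]

/-- Restriction does not raise the degree. [folklore] -/
theorem totalDegree_restrictVar_le (j : σ) (b : Bool) (p : MvPolynomial σ K) :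
    (restrictVar K j b p).totalDegree ≤ p.totalDegree := by
  cases b
  · rw [totalDegree, support_restrictVar_false]
    exact Finset.sup_mono (Finset.filter_subset _ _)
  · rw [restrictVar_true_eq_sum]
    refine totalDegree_finsetSum_le fun s hs => (totalDegree_monomial_le _ _).trans ?_
    refine le_trans ?_ (le_totalDegree hs)
    have h1 : ((s.erase j).sum fun _ => id) = (s.erase j).degree := sum_exponents_eq_degree _
    rw [h1, sum_exponents_eq_degree, Finsupp.degree_apply, Finsupp.degree_apply,
      Finsupp.support_erase]
    calc ∑ i ∈ s.support.erase j, (s.erase j) i = ∑ i ∈ s.support.erase j, s i :=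
          Finset.sum_congr rfl fun i hi => by rw [Finsupp.erase_ne (Finset.ne_of_mem_erase hi)]
      _ ≤ ∑ i ∈ s.support, s i := Finset.sum_le_sum_of_subset (Finset.erase_subset _ _)

/-- A polynomial not mentioning `x_j` is fixed by `x_j := b`. [folklore] -/
theorem restrictVar_eq_self_of_notMem_vars {j : σ} {p : MvPolynomial σ K} (h : j ∉ p.vars)
    (b : Bool) : restrictVar K j b p = p := by
  conv_rhs => rw [← AlgHom.id_apply (R := K) p, ← bind₁_X_left]
  rw [restrictVar]
  refine hom_congr_vars (by ext a; simp) (fun i hi _ => ?_) rfl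
  have hij : i ≠ j := fun hij => h (hij ▸ hi)
  simp [hij]

/-- Variables after restriction are among the original ones. [folklore] -/
theorem vars_restrictVar_subset (j : σ) (b : Bool) (p : MvPolynomial σ K) :
    (restrictVar K j b p).vars ⊆ p.vars := by
  intro i hi
  rw [mem_vars_iff_mem_support] at hi ⊢
  obtain ⟨t, ht, hit⟩ := hi
  cases b
  · rw [support_restrictVar_false, Finset.mem_filter] at ht
    exact ⟨t, ht.1, hit⟩
  · obtain ⟨s, hs, rfl⟩ := Finset.mem_image.1 (support_restrictVar_true_subset j p ht)
    rw [Finsupp.support_erase] at hit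
    exact ⟨s, hs, Finset.mem_of_mem_erase hit⟩

/-! ### Fat monomials of a line and how they move under restrictions -/

omit [DecidableEq σ] in
/-- The FAT monomials of a line: those with at least `D` variables. [Impagliazzo–Pudlák–Sgall
1999] [cite: KrajicekProofComplexity2019, Thm 16.2.4 (i)] -/
def bigMons (D : ℕ) (g : MvPolynomial σ K) : Finset (σ →₀ ℕ) :=
  g.support.filter fun s => D ≤ s.support.card

omit [DecidableEq σ] in
/-- Membership in `bigMons`. [folklore] -/
theorem mem_bigMons {D : ℕ} {g : MvPolynomial σ K} {s : σ →₀ ℕ} :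
    s ∈ bigMons D g ↔ s ∈ g.support ∧ D ≤ s.support.card := Finset.mem_filter

omit [DecidableEq σ] in
/-- **Double counting**: if every member of the nonempty `M` has `≥ D` variables, all in `W`,
then some variable of `W` lies in at least `D|M|/|W|` members of `M`.
[Clegg–Edmonds–Impagliazzo 1996; Impagliazzo–Pudlák–Sgall 1999] [folklore] -/
theorem exists_var_many {D : ℕ} {M : Finset (σ →₀ ℕ)} {W : Finset σ} (hW : ∀ m ∈ M, m.support ⊆ W)
    (hD : ∀ m ∈ M, D ≤ m.support.card) (hWne : W.Nonempty) :
    ∃ x ∈ W, D * M.card ≤ W.card * (M.filter fun m => m x ≠ 0).card := by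
  have hcount : D * M.card ≤ ∑ x ∈ W, (M.filter fun m => m x ≠ 0).card := by
    calc D * M.card = ∑ _m ∈ M, D := by rw [Finset.sum_const, smul_eq_mul, mul_comm]
      _ ≤ ∑ m ∈ M, m.support.card := Finset.sum_le_sum hD
      _ = ∑ m ∈ M, ∑ x ∈ W, if m x ≠ 0 then 1 else 0 := by
          refine Finset.sum_congr rfl fun m hm => ?_
          rw [Finset.sum_boole, Nat.cast_id]
          congr 1
          ext x
          simp only [Finset.mem_filter, Finsupp.mem_support_iff, iff_and_self]
          exact fun hx => hW m hm (Finsupp.mem_support_iff.2 hx)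
      _ = ∑ x ∈ W, ∑ m ∈ M, if m x ≠ 0 then 1 else 0 := Finset.sum_comm
      _ = ∑ x ∈ W, (M.filter fun m => m x ≠ 0).card := by
          refine Finset.sum_congr rfl fun x _ => ?_
          rw [Finset.sum_boole, Nat.cast_id]
  have hsum : ∑ _x ∈ W, D * M.card ≤ ∑ x ∈ W, W.card * (M.filter fun m => m x ≠ 0).card := by
    rw [Finset.sum_const, smul_eq_mul, ← Finset.mul_sum]
    exact Nat.mul_le_mul_left _ hcount
  exact Finset.exists_le_of_sum_le hWne hsum

/-- Under `x_j := 0` the fat monomials are the old fat monomials avoiding `x_j`. [folklore] -/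
theorem bigMons_restrictVar_false_subset {D : ℕ} {g : MvPolynomial σ K} {M : Finset (σ →₀ ℕ)}
    (hM : bigMons D g ⊆ M) (j : σ) :
    bigMons D (restrictVar K j false g) ⊆ M.filter fun m => m j = 0 := by
  intro s hs
  rw [mem_bigMons, support_restrictVar_false, Finset.mem_filter] at hs
  exact Finset.mem_filter.2 ⟨hM (mem_bigMons.2 ⟨hs.1.1, hs.2⟩), hs.1.2⟩

/-- The DESCENT of a set of monomials along `x_j := 1`: the members avoiding `x_j`, together with
the erasures `m ∖ j` of the members containing `x_j` that still have `≥ D` variables.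
[Impagliazzo–Pudlák–Sgall 1999] [folklore] -/
def descend (j : σ) (D : ℕ) (M : Finset (σ →₀ ℕ)) : Finset (σ →₀ ℕ) :=
  (M.filter fun m => m j = 0) ∪
    ((M.filter fun m => m j ≠ 0).image fun m => m.erase j).filter fun m => D ≤ m.support.card

/-- Under `x_j := 1` the fat monomials of a multilinear line descend. [Impagliazzo–Pudlák–Sgall
1999] [folklore] -/
theorem bigMons_restrictVar_true_subset {D : ℕ} {g : MvPolynomial σ K} (hg : ml K g = g)
    {M : Finset (σ →₀ ℕ)} (hM : bigMons D g ⊆ M) (j : σ) :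
    bigMons D (restrictVar K j true g) ⊆ descend j D M := by
  intro t ht
  rw [mem_bigMons] at ht
  obtain ⟨htj, h | h⟩ := mem_support_restrictVar_true_of_ml_eq_self hg ht.1
  · exact Finset.mem_union_left _ (Finset.mem_filter.2 ⟨hM (mem_bigMons.2 ⟨h, ht.2⟩), htj⟩)
  · refine Finset.mem_union_right _ (Finset.mem_filter.2 ⟨Finset.mem_image.2 ?_, ht.2⟩)
    refine ⟨t + Finsupp.single j 1, Finset.mem_filter.2 ⟨hM (mem_bigMons.2 ⟨h, ?_⟩), ?_⟩, ?_⟩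
    · refine ht.2.trans (Finset.card_le_card fun i hi => ?_)
      rw [Finsupp.mem_support_iff] at hi ⊢
      rw [Finsupp.add_apply]
      omega
    · rw [Finsupp.add_apply, Finsupp.single_eq_same]; omega
    · ext i
      by_cases hij : i = j
      · rw [hij, Finsupp.erase_same, htj]
      · rw [Finsupp.erase_ne hij, Finsupp.add_apply, Finsupp.single_eq_of_ne hij, add_zero]

/-- The descent is no larger. [Impagliazzo–Pudlák–Sgall 1999] [folklore] -/
theorem card_descend_le (j : σ) (D : ℕ) (M : Finset (σ →₀ ℕ)) :
    (descend j D M).card ≤ M.card := by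
  refine (Finset.card_union_le _ _).trans ?_
  refine (Nat.add_le_add_left ((Finset.card_filter_le _ _).trans Finset.card_image_le) _).trans ?_
  rw [Finset.card_filter_add_card_filter_not]

/-- Members of the descent avoid `x_j` and live on the old variables. [folklore] -/
theorem support_subset_of_mem_descend {j : σ} {D : ℕ} {M : Finset (σ →₀ ℕ)} {W : Finset σ}
    (hW : ∀ m ∈ M, m.support ⊆ W) {m : σ →₀ ℕ} (hm : m ∈ descend j D M) :
    m.support ⊆ W.erase j := by
  rcases Finset.mem_union.1 hm with h | h
  · obtain ⟨hmM, hmj⟩ := Finset.mem_filter.1 h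
    intro i hi
    refine Finset.mem_erase.2 ⟨?_, hW m hmM hi⟩
    rintro rfl
    exact (Finsupp.mem_support_iff.1 hi) hmj
  · obtain ⟨h1, _⟩ := Finset.mem_filter.1 h
    obtain ⟨m', hm', rfl⟩ := Finset.mem_image.1 h1
    rw [Finsupp.support_erase]
    exact Finset.erase_subset_erase _ (hW m' (Finset.mem_filter.1 hm').1)

/-- Members of the descent are fat. [folklore] -/
theorem le_card_of_mem_descend {j : σ} {D : ℕ} {M : Finset (σ →₀ ℕ)}
    (hD : ∀ m ∈ M, D ≤ m.support.card) {m : σ →₀ ℕ} (hm : m ∈ descend j D M) :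
    D ≤ m.support.card := by
  rcases Finset.mem_union.1 hm with h | h
  · exact hD m (Finset.mem_filter.1 h).1
  · exact (Finset.mem_filter.1 h).2

end Literature.Computability.MetaComplexity.MLPC
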